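import Summits.AtomisticToContinuum.Crystallization.Theorems.ChartedPlanarOrderPlanesRearrangement
import Summits.AtomisticToContinuum.Crystallization.Theorems.ChartedPlanarOrderPlanesWindow

/-!
# Slot 7b by the method of planes, module P3g: the planes estimate for the layerwise truncated virial (decomp-a2c lens-3 g26; critic row 523 (b) (g1))

Blocker `N = ChartedPlanarOrder.ChartedZeroExcessLayered`, leaf 7b `GapStressVanishesW (17/16)`.  Setting of modules P3c–P3e: a stacked layered
configuration `Y = Layered a b w`, unit normal `ν ⊥ a, b`, heights `h_m = z_m − z_{m−1} ∈ [h_lo, h_hi]` (`z_j = ⟪ν, w j⟫`), range `R`, a chunk `F`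
with layer counts `N_k` whose layers lie in a window `[K₀ + M₀, K₁ − M₀]`, and a CONSTANT transmitted stress `gapStress a b m (incr w) = σ` for
all gaps `m`.  THE PLANES ESTIMATE (`abs_planes_le`):

  `|Σ_k N_k col k + ⟪v, σ⟫ · W| ≤ ‖v‖ (C₂/R · W + 4 s₀³ h_hi Φmax · TV)`,

`W = Σ_m h_m (N_{m−1} + N_m) ∈ [2 h_lo #F, 2 h_hi #F]` (`Wt_bounds`), `TV = Σ_j |N_{j+1} − N_j|` over the gaps near the window, `Φmax = 64 K(δ)(δ/2h_lo)³`,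
`C₂ = Φmax (2 h_hi + δ)`.  Route: (1) each column load is a window sum of the symmetric pair function `S(k,l) = (z_k − z_l)⟪v, Φ_R(k,l)⟫`
(oddness of `Φ_R`, vanishing beyond `s₀` layers); (2) symmetrisation `Σ_k N_k Σ_l S = Σ_{k<l} (N_k + N_l) S` (`…PlanesWindow`); (3) the planes
identity with weights (`…PlanesIdentity.sum_pairs_heights_weights`): `= −Σ_m h_m Σ_{k<m≤l} (N_k + N_l) ⟪v, Φ_R(k,l)⟫`; (4) per gap, the weights
`N_k + N_l` are replaced by `N_{m−1} + N_m` at a cost controlled by the local total variation of `N` (`abs_weights_sub_le`, at most `s₀²` pairs of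
span `≤ s₀`), and the window sum `Σ_{k<m≤l} Φ_R(k,l)` by `σ` at cost `C₂/R` (the truncation law `…PlanesTail.norm_gapStress_sub_sum_PhiR_le`).

Mathlib only (+ the lens-3 modules imported); `[folklore]`; no instances, no notation, sorry-free.
-/

noncomputable section

open Finset
open scoped RealInnerProductSpace
open Summit.AtomisticToContinuum.Crystallization.Theorems.ChartedPlanarOrderRigidityDoor
open Summit.AtomisticToContinuum.Crystallization.Theorems.ChartedPlanarOrderDensityDichotomy
open Summit.AtomisticToContinuum.Crystallization.Theorems.ChartedPlanarOrderMesoCut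
open Summit.AtomisticToContinuum.Crystallization.Theorems.ChartedPlanarOrderProfileSlavingLJ (IsStacked gapStress incr)
open Summit.AtomisticToContinuum.Crystallization.Theorems.ChartedPlanarOrderDoorLayered (Layered)
open Summit.AtomisticToContinuum.Crystallization.Theorems.ChartedPlanarOrderNashForceBalance
open Summit.AtomisticToContinuum.Crystallization.Theorems.ChartedPlanarOrderPlanesPairs (Kc Kc_nonneg isStacked_of_heights)
open Summit.AtomisticToContinuum.Crystallization.Theorems.ChartedPlanarOrderPlanesTail
open Summit.AtomisticToContinuum.Crystallization.Theorems.ChartedPlanarOrderPlanesCount (idx mem_idx layerCount sum_layerCount)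
open Summit.AtomisticToContinuum.Crystallization.Theorems.ChartedPlanarOrderPlanesRearrangement (col)
open Summit.AtomisticToContinuum.Crystallization.Theorems.ChartedPlanarOrderPlanesIdentity (sum_pairs_heights_weights abs_weights_sub_le)
open Summit.AtomisticToContinuum.Crystallization.Theorems.ChartedPlanarOrderPlanesWindow

namespace Summit.AtomisticToContinuum.Crystallization.Theorems.ChartedPlanarOrderPlanesVirial

variable {δ : ℝ} {a b ν : E3} {w : ℤ → E3} {h_lo h_hi : ℝ}

/-! ## 1. Constants, the symmetric pair function, column loads as window sums -/
section Pairs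

/-- `Φmax = 64 K(δ) (δ/2h_lo)³`, the uniform bound on `‖Φ_R(k,l)‖` (`…PlanesTail.norm_PhiR_le`). -/
def PhiMax (δ h_lo : ℝ) : ℝ := 64 * Kc δ * (δ / (2 * h_lo)) ^ 3

/-- `C₂ = Φmax (2 h_hi + δ)`, the constant of the truncation law (`…PlanesTail.norm_gapStress_sub_sum_PhiR_le`). -/
def C2 (δ h_lo h_hi : ℝ) : ℝ := 64 * Kc δ * (δ / (2 * h_lo)) ^ 3 * (2 * h_hi + δ)

/-- `PhiMax δ h_lo ≥ 0`. -/
theorem PhiMax_nonneg (hδ : 0 < δ) (hlo : 0 ≤ h_lo) : 0 ≤ PhiMax δ h_lo := by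
  have := Kc_nonneg hδ; unfold PhiMax; positivity

/-- `C2 δ h_lo h_hi ≥ 0`. -/
theorem C2_nonneg (hδ : 0 < δ) (hlo : 0 ≤ h_lo) (hhi : 0 ≤ h_hi) : 0 ≤ C2 δ h_lo h_hi := by
  have := Kc_nonneg hδ; unfold C2; positivity

/-- the symmetric pair function `S(k,l) = (z_k − z_l) ⟪v, Φ_R(k,l)⟫`. -/
def Sfun (a b : E3) (w : ℤ → E3) (ν v : E3) (R : ℝ) (k l : ℤ) : ℝ := (⟪ν, w k⟫ - ⟪ν, w l⟫) * ⟪v, PhiR a b w R k l⟫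

/-- `Sfun` is symmetric in the two layer indices (oddness of `PhiR`). -/
theorem Sfun_symm (hδ : 0 < δ) (hS : IsSep δ (Layered a b w)) (hab : LinearIndependent ℝ ![a, b]) (hst : IsStacked a b w)
    (v : E3) (R : ℝ) (k l : ℤ) : Sfun a b w ν v R l k = Sfun a b w ν v R k l := by
  unfold Sfun
  rw [PhiR_swap hδ hS hab hst R k l, inner_neg_right]
  ring

/-- `Sfun` vanishes on the diagonal. -/
theorem Sfun_self (v : E3) (R : ℝ) (k : ℤ) : Sfun a b w ν v R k k = 0 := by
  unfold Sfun; ring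

/-- spans beyond `s₀` layers are beyond the range. -/
theorem far_of_span (hlo : 0 < h_lo) {R : ℝ} {s₀ : ℕ} (hs₀ : R < h_lo * ((s₀ : ℝ) + 1)) {k l : ℤ} (h : (s₀ : ℤ) + 1 ≤ |l - k|) :
    R < h_lo * |((l - k : ℤ) : ℝ)| := by
  have h1 : (s₀ : ℝ) + 1 ≤ |((l - k : ℤ) : ℝ)| := by
    rw [← Int.cast_abs]
    exact_mod_cast h
  exact lt_of_lt_of_le hs₀ (mul_le_mul_of_nonneg_left h1 hlo.le)

/-- `|⟪v, Φ_R(k,l)⟫| ≤ ‖v‖ Φmax` for `k ≠ l`. -/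
theorem abs_inner_PhiR_le (hδ : 0 < δ) (hS : IsSep δ (Layered a b w)) (hab : LinearIndependent ℝ ![a, b])
    (hνa : ⟪ν, a⟫ = 0) (hνb : ⟪ν, b⟫ = 0) (hlo : 0 < h_lo)
    (hH : ∀ j : ℤ, h_lo ≤ ⟪ν, w (j + 1) - w j⟫ ∧ ⟪ν, w (j + 1) - w j⟫ ≤ h_hi)
    (e : OrthonormalBasis (Fin 3) ℝ E3) (he : e 0 = ν) (R : ℝ) (v : E3) {k l : ℤ} (hkl : k ≠ l) :
    |⟪v, PhiR a b w R k l⟫| ≤ ‖v‖ * PhiMax δ h_lo :=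
  (abs_real_inner_le_norm v _).trans (mul_le_mul_of_nonneg_left (norm_PhiR_le hδ hS hab hνa hνb hlo hH e he R hkl) (norm_nonneg v))

/-- (1) the column load of a layer deep inside the window is the window sum of `S(k, ·)`. -/
theorem col_eq_sum_window (hν : ‖ν‖ = 1) (hνa : ⟪ν, a⟫ = 0) (hνb : ⟪ν, b⟫ = 0) (hlo : 0 < h_lo)
    (hH : ∀ j : ℤ, h_lo ≤ ⟪ν, w (j + 1) - w j⟫ ∧ ⟪ν, w (j + 1) - w j⟫ ≤ h_hi)
    {R : ℝ} {s₀ : ℕ} (hs₀ : R < h_lo * ((s₀ : ℝ) + 1)) (v : E3) {K₀ K₁ k : ℤ} (hk₀ : K₀ + s₀ ≤ k) (hk₁ : k + s₀ ≤ K₁) :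
    col a b w ν v R s₀ k = ∑ l ∈ Icc K₀ K₁, Sfun a b w ν v R k l := by
  unfold col Sfun
  refine sum_subset (Icc_subset_Icc (by omega) (by omega)) fun l _ hl' => ?_
  rw [mem_Icc, not_and_or, not_le, not_le] at hl'
  have hfar : (s₀ : ℤ) + 1 ≤ |l - k| := by
    rcases hl' with h | h
    · exact le_abs.mpr (Or.inr (by omega))
    · exact le_abs.mpr (Or.inl (by omega))
  rw [PhiR_eq_zero_of_far hν hνa hνb hH (far_of_span hlo hs₀ hfar), inner_zero_right, mul_zero]

end Pairs

/-! ## 2. Layer counts on the window; symmetrisation and the planes identity -/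
section Window

/-- layers not met by the chunk have count zero. -/
theorem layerCount_eq_zero (hinj : Function.Injective (layerPoint a b w)) (F : Finset E3) {k : ℤ}
    (hk : k ∉ (idx a b w hinj F).image (fun s => s.1)) : layerCount hinj F k = 0 := by
  unfold layerCount
  rw [card_eq_zero, filter_eq_empty_iff]
  intro s hs hsk
  exact hk (mem_image.mpr ⟨s, hs, hsk⟩)

/-- a nonzero layer count is a layer of the chunk. -/
theorem exists_of_layerCount_ne_zero (hinj : Function.Injective (layerPoint a b w)) (F : Finset E3) {k : ℤ}
    (hk : layerCount hinj F k ≠ 0) : ∃ s ∈ idx a b w hinj F, s.1 = k := by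
  by_contra hno
  apply hk
  apply layerCount_eq_zero hinj F
  intro hmem
  obtain ⟨s, hs, hsk⟩ := mem_image.mp hmem
  exact hno ⟨s, hs, hsk⟩

/-- (1') the layerwise truncated virial as a weighted double window sum of `S`. -/
theorem sum_layerCount_mul_col_eq (hν : ‖ν‖ = 1) (hνa : ⟪ν, a⟫ = 0) (hνb : ⟪ν, b⟫ = 0) (hlo : 0 < h_lo)
    (hH : ∀ j : ℤ, h_lo ≤ ⟪ν, w (j + 1) - w j⟫ ∧ ⟪ν, w (j + 1) - w j⟫ ≤ h_hi)
    {R : ℝ} {s₀ : ℕ} (hs₀ : R < h_lo * ((s₀ : ℝ) + 1)) (v : E3)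
    (hinj : Function.Injective (layerPoint a b w)) (F : Finset E3) {K₀ K₁ : ℤ} {M₀ : ℕ} (hsM : s₀ ≤ M₀)
    (hΛ : ∀ s ∈ idx a b w hinj F, K₀ + M₀ ≤ s.1 ∧ s.1 ≤ K₁ - M₀) :
    ∑ k ∈ (idx a b w hinj F).image (fun s => s.1), (layerCount hinj F k : ℝ) * col a b w ν v R s₀ k =
      ∑ k ∈ Icc K₀ K₁, ∑ l ∈ Icc K₀ K₁, (layerCount hinj F k : ℝ) * Sfun a b w ν v R k l := by
  have hΛW : (idx a b w hinj F).image (fun s => s.1) ⊆ Icc K₀ K₁ := by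
    intro k hk
    obtain ⟨s, hs, rfl⟩ := mem_image.mp hk
    have h := hΛ s hs
    rw [mem_Icc]
    constructor <;> omega
  rw [sum_subset hΛW (fun k _ hk => by rw [layerCount_eq_zero hinj F hk, Nat.cast_zero, zero_mul])]
  refine sum_congr rfl fun k _ => ?_
  by_cases hN : layerCount hinj F k = 0
  · rw [hN, Nat.cast_zero, zero_mul]
    exact (sum_eq_zero fun l _ => by rw [zero_mul]).symm
  · obtain ⟨s, hs, hsk⟩ := exists_of_layerCount_ne_zero hinj F hN
    have hb := hΛ s hs
    rw [hsk] at hb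
    rw [col_eq_sum_window hν hνa hνb hlo hH hs₀ v (K₀ := K₀) (K₁ := K₁) (by omega) (by omega), mul_sum]

/-- (2)+(3) symmetrisation and the planes identity with weights: for ANY weights `N`,
`Σ_{K₀ ≤ k < l ≤ K₁} (N_k + N_l) S(k,l) = −Σ_m h_m Σ_{k<m≤l} (N_k + N_l) ⟪v, Φ_R(k,l)⟫`. -/
theorem sum_sum_weights_Sfun (v : E3) (R : ℝ) (N : ℤ → ℝ) (K₀ K₁ : ℤ) :
    ∑ k ∈ Icc K₀ K₁, ∑ l ∈ Ioc k K₁, (N k + N l) * Sfun a b w ν v R k l =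
      -∑ m ∈ Ioc K₀ K₁, (⟪ν, w m⟫ - ⟪ν, w (m - 1)⟫) *
        ∑ k ∈ Ico K₀ m, ∑ l ∈ Icc m K₁, (N k + N l) * ⟪v, PhiR a b w R k l⟫ := by
  have h1 : ∀ k ∈ Icc K₀ K₁, ∀ l ∈ Ioc k K₁, (N k + N l) * Sfun a b w ν v R k l =
      -(((N k + N l) * ∑ m ∈ Ioc k l, (⟪ν, w m⟫ - ⟪ν, w (m - 1)⟫)) • ⟪v, PhiR a b w R k l⟫) := by
    intro k _ l hl
    rw [mem_Ioc] at hl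
    rw [sum_Ioc_sub (fun m => ⟪ν, w m⟫) hl.1.le, Sfun, smul_eq_mul]
    ring
  rw [sum_congr rfl fun k hk => sum_congr rfl fun l hl => h1 k hk l hl]
  simp only [sum_neg_distrib]
  rw [sum_pairs_heights_weights K₀ K₁ (fun m => ⟪ν, w m⟫ - ⟪ν, w (m - 1)⟫) N (fun k l => ⟪v, PhiR a b w R k l⟫)]
  simp only [smul_eq_mul]

end Window

/-! ## 3. Per-gap errors: weight replacement and the truncation law -/
section Gap

/-- (4a) WEIGHT REPLACEMENT at gap `m`: `|Σ_{k<m≤l} ((N_k + N_l) − (N_{m−1} + N_m)) ⟪v, Φ_R(k,l)⟫| ≤ 2 s₀² ‖v‖ Φmax · Σ_{j ∈ [m−s₀, m+s₀)} |N_{j+1} − N_j|`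
(pairs of span `> s₀` carry no truncated force; the others number `≤ s₀²` and telescope inside `[m − s₀, m + s₀)`). -/
theorem abs_weightErr_le (hδ : 0 < δ) (hS : IsSep δ (Layered a b w)) (hab : LinearIndependent ℝ ![a, b])
    (hν : ‖ν‖ = 1) (hνa : ⟪ν, a⟫ = 0) (hνb : ⟪ν, b⟫ = 0) (hlo : 0 < h_lo)
    (hH : ∀ j : ℤ, h_lo ≤ ⟪ν, w (j + 1) - w j⟫ ∧ ⟪ν, w (j + 1) - w j⟫ ≤ h_hi)
    (e : OrthonormalBasis (Fin 3) ℝ E3) (he : e 0 = ν) {R : ℝ} {s₀ : ℕ} (hs₀ : R < h_lo * ((s₀ : ℝ) + 1)) (v : E3)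
    (N : ℤ → ℝ) (m K₀ K₁ : ℤ) :
    |∑ k ∈ Ico K₀ m, ∑ l ∈ Icc m K₁, ((N k + N l) - (N (m - 1) + N m)) * ⟪v, PhiR a b w R k l⟫| ≤
      2 * (s₀ : ℝ) ^ 2 * (‖v‖ * PhiMax δ h_lo) * ∑ j ∈ Ico (m - s₀) (m + s₀), |N (j + 1) - N j| := by
  set T := ∑ j ∈ Ico (m - s₀) (m + s₀), |N (j + 1) - N j| with hT
  have hT0 : 0 ≤ T := sum_nonneg fun j _ => abs_nonneg _
  have hΦ := PhiMax_nonneg hδ hlo.le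
  have key : ∀ k ∈ Ico K₀ m, ∀ l ∈ Icc m K₁, |((N k + N l) - (N (m - 1) + N m)) * ⟪v, PhiR a b w R k l⟫| ≤
      (if l - k ≤ (s₀ : ℤ) then 2 * (‖v‖ * PhiMax δ h_lo) * T else 0) := by
    intro k hk l hl
    rw [mem_Ico] at hk
    rw [mem_Icc] at hl
    split_ifs with hspan
    · rw [abs_mul]
      have h1 := abs_weights_sub_le N hk.2 hl.1
      have h2 : ∑ j ∈ Ico k l, |N (j + 1) - N j| ≤ T :=
        sum_le_sum_of_subset_of_nonneg (Ico_subset_Ico (by omega) (by omega)) fun _ _ _ => abs_nonneg _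
      have h3 := abs_inner_PhiR_le hδ hS hab hνa hνb hlo hH e he R v (show k ≠ l by omega)
      calc |(N k + N l) - (N (m - 1) + N m)| * |⟪v, PhiR a b w R k l⟫| ≤ (2 * T) * (‖v‖ * PhiMax δ h_lo) :=
            mul_le_mul (h1.trans (by linarith)) h3 (abs_nonneg _) (by positivity)
        _ = 2 * (‖v‖ * PhiMax δ h_lo) * T := by ring
    · rw [PhiR_eq_zero_of_far hν hνa hνb hH (far_of_span hlo hs₀ (le_abs.mpr (Or.inl (by omega)))), inner_zero_right,
        mul_zero, abs_zero]
  refine (abs_sum_le_sum_abs _ _).trans ?_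
  refine (sum_le_sum fun k _ => abs_sum_le_sum_abs _ _).trans ?_
  refine (sum_le_sum fun k hk => sum_le_sum fun l hl => key k hk l hl).trans ?_
  have h := sum_sum_ite_span_le K₀ K₁ m s₀ (C := 2 * (‖v‖ * PhiMax δ h_lo) * T) (by positivity)
  exact h.trans (le_of_eq (by ring))

/-- (4b) THE TRUNCATION LAW at gap `m`, tested against `v`. -/
theorem abs_windowSum_sub_le (hδ : 0 < δ) (hS : IsSep δ (Layered a b w)) (hab : LinearIndependent ℝ ![a, b])
    (hν : ‖ν‖ = 1) (hνa : ⟪ν, a⟫ = 0) (hνb : ⟪ν, b⟫ = 0) (hlo : 0 < h_lo) (hhi : 0 < h_hi)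
    (hH : ∀ j : ℤ, h_lo ≤ ⟪ν, w (j + 1) - w j⟫ ∧ ⟪ν, w (j + 1) - w j⟫ ≤ h_hi)
    (e : OrthonormalBasis (Fin 3) ℝ E3) (he : e 0 = ν) {R : ℝ} (hR : 0 < R) {K₀ K₁ m : ℤ}
    (hK₀ : R ≤ h_lo * ((m - K₀ : ℤ) : ℝ)) (hK₁ : R ≤ h_lo * ((K₁ + 1 - m : ℤ) : ℝ)) (v σ : E3)
    (hσ : gapStress a b m (incr w) = σ) :
    |∑ k ∈ Ico K₀ m, ∑ l ∈ Icc m K₁, ⟪v, PhiR a b w R k l⟫ - ⟪v, σ⟫| ≤ ‖v‖ * (C2 δ h_lo h_hi / R) := by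
  have hD := norm_gapStress_sub_sum_PhiR_le hδ hS hab hν hνa hνb hlo hhi hH e he hR hK₀ hK₁
  rw [hσ] at hD
  simp only [← inner_sum]
  rw [← inner_sub_right, ← neg_sub, inner_neg_right, abs_neg]
  refine (abs_real_inner_le_norm _ _).trans (mul_le_mul_of_nonneg_left (hD.trans (le_of_eq ?_)) (norm_nonneg v))
  rw [C2]

end Gap

/-! ## 4. ★ The planes estimate; the total weight -/
section Planes

/-- ★★ THE PLANES ESTIMATE. -/
theorem abs_planes_le (hδ : 0 < δ) (hS : IsSep δ (Layered a b w)) (hab : LinearIndependent ℝ ![a, b])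
    (hν : ‖ν‖ = 1) (hνa : ⟪ν, a⟫ = 0) (hνb : ⟪ν, b⟫ = 0) (hlo : 0 < h_lo) (hhi : 0 < h_hi)
    (hH : ∀ j : ℤ, h_lo ≤ ⟪ν, w (j + 1) - w j⟫ ∧ ⟪ν, w (j + 1) - w j⟫ ≤ h_hi)
    (e : OrthonormalBasis (Fin 3) ℝ E3) (he : e 0 = ν) {R : ℝ} (hR : 0 < R) {s₀ : ℕ} (hs₀ : R < h_lo * ((s₀ : ℝ) + 1))
    (v : E3) (hinj : Function.Injective (layerPoint a b w)) (F : Finset E3) {K₀ K₁ : ℤ} {M₀ : ℕ} (hsM : s₀ + 1 ≤ M₀)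
    (hM₀R : R ≤ h_lo * (M₀ : ℝ)) (hΛ : ∀ s ∈ idx a b w hinj F, K₀ + M₀ ≤ s.1 ∧ s.1 ≤ K₁ - M₀)
    (σ : E3) (hσ : ∀ m : ℤ, gapStress a b m (incr w) = σ) :
    |∑ k ∈ (idx a b w hinj F).image (fun s => s.1), (layerCount hinj F k : ℝ) * col a b w ν v R s₀ k +
        ⟪v, σ⟫ * ∑ m ∈ Ioc K₀ K₁, (⟪ν, w m⟫ - ⟪ν, w (m - 1)⟫) * ((layerCount hinj F (m - 1) : ℝ) + layerCount hinj F m)| ≤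
      ‖v‖ * (C2 δ h_lo h_hi / R * ∑ m ∈ Ioc K₀ K₁, (⟪ν, w m⟫ - ⟪ν, w (m - 1)⟫) * ((layerCount hinj F (m - 1) : ℝ) + layerCount hinj F m) +
        4 * (s₀ : ℝ) ^ 3 * h_hi * PhiMax δ h_lo *
          ∑ j ∈ Ico (K₀ - s₀) (K₁ + s₀), |(layerCount hinj F (j + 1) : ℝ) - layerCount hinj F j|) := by
  have hst : IsStacked a b w := isStacked_of_heights hνa hνb hlo hH
  have hΦ := PhiMax_nonneg hδ hlo.le
  have hC := C2_nonneg hδ hlo.le hhi.le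
  have hv := norm_nonneg v
  -- steps (1)–(3): the window form of the layerwise truncated virial
  have step1 := sum_layerCount_mul_col_eq hν hνa hνb hlo hH hs₀ v hinj F (show s₀ ≤ M₀ by omega) hΛ
  rw [sum_sum_mul_symm K₀ K₁ _ (Sfun a b w ν v R) (fun k l => Sfun_symm hδ hS hab hst v R k l) (fun k => Sfun_self v R k),
    sum_sum_weights_Sfun v R _ K₀ K₁] at step1
  -- abbreviations `N`, `hgt`, `f`, `T`
  obtain ⟨N, hN⟩ : ∃ N : ℤ → ℝ, ∀ k, (layerCount hinj F k : ℝ) = N k := ⟨_, fun _ => rfl⟩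
  obtain ⟨hgt, hhgt⟩ : ∃ hgt : ℤ → ℝ, ∀ m, ⟪ν, w m⟫ - ⟪ν, w (m - 1)⟫ = hgt m := ⟨_, fun _ => rfl⟩
  obtain ⟨f, hf⟩ : ∃ f : ℤ → ℤ → ℝ, ∀ k l, ⟪v, PhiR a b w R k l⟫ = f k l := ⟨_, fun _ _ => rfl⟩
  have hN0 : ∀ k, 0 ≤ N k := fun k => by rw [← hN]; exact Nat.cast_nonneg _
  have hgt_bd : ∀ m, h_lo ≤ hgt m ∧ hgt m ≤ h_hi := fun m => by
    have h := hH (m - 1)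
    rw [sub_add_cancel, inner_sub_right, hhgt] at h
    exact h
  simp only [hN, hhgt, hf] at step1 ⊢
  obtain ⟨T, hT⟩ : ∃ T : ℤ → ℝ, ∀ m : ℤ, ∑ j ∈ Ico (m - (s₀ : ℤ)) (m + (s₀ : ℤ)), |N (j + 1) - N j| = T m :=
    ⟨_, fun _ => rfl⟩
  have hT0 : ∀ m, 0 ≤ T m := fun m => by rw [← hT]; exact sum_nonneg fun j _ => abs_nonneg _
  -- step (4): per-gap bound
  have step2 : ∀ m, |∑ k ∈ Ico K₀ m, ∑ l ∈ Icc m K₁, (N k + N l) * f k l - (N (m - 1) + N m) * ⟪v, σ⟫| ≤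
      (N (m - 1) + N m) * (‖v‖ * (C2 δ h_lo h_hi / R)) + 2 * (s₀ : ℝ) ^ 2 * (‖v‖ * PhiMax δ h_lo) * T m := by
    intro m
    have hA := abs_weightErr_le hδ hS hab hν hνa hνb hlo hH e he hs₀ v N m K₀ K₁
    simp only [hf, hT] at hA
    have hB : |(N (m - 1) + N m) * ∑ k ∈ Ico K₀ m, ∑ l ∈ Icc m K₁, f k l - (N (m - 1) + N m) * ⟪v, σ⟫| ≤
        (N (m - 1) + N m) * (‖v‖ * (C2 δ h_lo h_hi / R)) := by
      by_cases h0 : N (m - 1) + N m = 0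
      · rw [h0, zero_mul, zero_mul, sub_zero, abs_zero, zero_mul]
      · -- an atom of the chunk lies in layer `m − 1` or `m`: the gap is deep inside the window
        have hwin : (M₀ : ℤ) ≤ m - K₀ ∧ (M₀ : ℤ) ≤ K₁ + 1 - m := by
          have h1 : layerCount hinj F (m - 1) ≠ 0 ∨ layerCount hinj F m ≠ 0 := by
            by_contra hno
            rw [not_or, not_not, not_not] at hno
            apply h0
            rw [← hN, ← hN, hno.1, hno.2, Nat.cast_zero, add_zero]
          rcases h1 with h1 | h1
          · obtain ⟨s, hs, hsk⟩ := exists_of_layerCount_ne_zero hinj F h1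
            have hb := hΛ s hs
            rw [hsk] at hb
            constructor <;> omega
          · obtain ⟨s, hs, hsk⟩ := exists_of_layerCount_ne_zero hinj F h1
            have hb := hΛ s hs
            rw [hsk] at hb
            constructor <;> omega
        have hK₀ : R ≤ h_lo * ((m - K₀ : ℤ) : ℝ) :=
          hM₀R.trans (mul_le_mul_of_nonneg_left (by exact_mod_cast hwin.1) hlo.le)
        have hK₁ : R ≤ h_lo * ((K₁ + 1 - m : ℤ) : ℝ) :=
          hM₀R.trans (mul_le_mul_of_nonneg_left (by exact_mod_cast hwin.2) hlo.le)
        have hw := abs_windowSum_sub_le hδ hS hab hν hνa hνb hlo hhi hH e he hR hK₀ hK₁ v σ (hσ m)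
        simp only [hf] at hw
        rw [← mul_sub, abs_mul, abs_of_nonneg (add_nonneg (hN0 _) (hN0 _))]
        exact mul_le_mul_of_nonneg_left hw (add_nonneg (hN0 _) (hN0 _))
    have hsplit : ∑ k ∈ Ico K₀ m, ∑ l ∈ Icc m K₁, (N k + N l) * f k l - (N (m - 1) + N m) * ⟪v, σ⟫ =
        ∑ k ∈ Ico K₀ m, ∑ l ∈ Icc m K₁, ((N k + N l) - (N (m - 1) + N m)) * f k l +
          ((N (m - 1) + N m) * ∑ k ∈ Ico K₀ m, ∑ l ∈ Icc m K₁, f k l - (N (m - 1) + N m) * ⟪v, σ⟫) := by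
      have h1 : ∑ k ∈ Ico K₀ m, ∑ l ∈ Icc m K₁, ((N k + N l) - (N (m - 1) + N m)) * f k l =
          ∑ k ∈ Ico K₀ m, ∑ l ∈ Icc m K₁, (N k + N l) * f k l -
            (N (m - 1) + N m) * ∑ k ∈ Ico K₀ m, ∑ l ∈ Icc m K₁, f k l := by
        simp only [sub_mul, sum_sub_distrib, mul_sum]
      rw [h1]
      ring
    rw [hsplit]
    exact (abs_add_le _ _).trans (by linarith [hA, hB])
  have step4 : ∑ m ∈ Ioc K₀ K₁, T m ≤ 2 * (s₀ : ℝ) * ∑ j ∈ Ico (K₀ - s₀) (K₁ + s₀), |N (j + 1) - N j| := by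
    have h := sum_sum_Ico_le K₀ K₁ s₀ (fun j => |N (j + 1) - N j|) fun j => abs_nonneg _
    simp only [hT] at h
    exact h
  -- assemble
  rw [step1]
  have e1 : -∑ m ∈ Ioc K₀ K₁, hgt m * ∑ k ∈ Ico K₀ m, ∑ l ∈ Icc m K₁, (N k + N l) * f k l +
      ⟪v, σ⟫ * ∑ m ∈ Ioc K₀ K₁, hgt m * (N (m - 1) + N m) =
        -∑ m ∈ Ioc K₀ K₁, hgt m * (∑ k ∈ Ico K₀ m, ∑ l ∈ Icc m K₁, (N k + N l) * f k l - (N (m - 1) + N m) * ⟪v, σ⟫) := by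
    rw [mul_sum, ← sum_neg_distrib, ← sum_neg_distrib, ← sum_add_distrib]
    exact sum_congr rfl fun m _ => by ring
  rw [e1, abs_neg]
  have hc0 : 0 ≤ 2 * (s₀ : ℝ) ^ 2 * (‖v‖ * PhiMax δ h_lo) * h_hi := by positivity
  calc |∑ m ∈ Ioc K₀ K₁, hgt m * (∑ k ∈ Ico K₀ m, ∑ l ∈ Icc m K₁, (N k + N l) * f k l - (N (m - 1) + N m) * ⟪v, σ⟫)|
      ≤ ∑ m ∈ Ioc K₀ K₁, |hgt m * (∑ k ∈ Ico K₀ m, ∑ l ∈ Icc m K₁, (N k + N l) * f k l - (N (m - 1) + N m) * ⟪v, σ⟫)| :=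
        abs_sum_le_sum_abs _ _
    _ ≤ ∑ m ∈ Ioc K₀ K₁, (hgt m * ((N (m - 1) + N m) * (‖v‖ * (C2 δ h_lo h_hi / R))) +
          h_hi * (2 * (s₀ : ℝ) ^ 2 * (‖v‖ * PhiMax δ h_lo) * T m)) := by
        refine sum_le_sum fun m _ => ?_
        have hg := hgt_bd m
        rw [abs_mul, abs_of_nonneg (hlo.le.trans hg.1)]
        have h1 := mul_le_mul_of_nonneg_left (step2 m) (hlo.le.trans hg.1)
        have h2 : hgt m * (2 * (s₀ : ℝ) ^ 2 * (‖v‖ * PhiMax δ h_lo) * T m) ≤ h_hi * (2 * (s₀ : ℝ) ^ 2 * (‖v‖ * PhiMax δ h_lo) * T m) :=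
          mul_le_mul_of_nonneg_right hg.2 (by have := hT0 m; positivity)
        rw [mul_add] at h1
        linarith
    _ = ‖v‖ * (C2 δ h_lo h_hi / R) * ∑ m ∈ Ioc K₀ K₁, hgt m * (N (m - 1) + N m) +
          2 * (s₀ : ℝ) ^ 2 * (‖v‖ * PhiMax δ h_lo) * h_hi * ∑ m ∈ Ioc K₀ K₁, T m := by
        rw [sum_add_distrib, mul_sum, mul_sum]
        congr 1 <;> exact sum_congr rfl fun m _ => by ring
    _ ≤ ‖v‖ * (C2 δ h_lo h_hi / R) * ∑ m ∈ Ioc K₀ K₁, hgt m * (N (m - 1) + N m) +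
          2 * (s₀ : ℝ) ^ 2 * (‖v‖ * PhiMax δ h_lo) * h_hi * (2 * (s₀ : ℝ) * ∑ j ∈ Ico (K₀ - s₀) (K₁ + s₀), |N (j + 1) - N j|) := by
        have h := mul_le_mul_of_nonneg_left step4 hc0
        linarith
    _ = _ := by ring

/-- the total weight `W = Σ_m h_m (N_{m−1} + N_m)` lies in `[2 h_lo #F, 2 h_hi #F]` (every atom is counted from the gap below and the gap above). -/
theorem Wt_bounds (hH : ∀ j : ℤ, h_lo ≤ ⟪ν, w (j + 1) - w j⟫ ∧ ⟪ν, w (j + 1) - w j⟫ ≤ h_hi)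
    (hinj : Function.Injective (layerPoint a b w)) (F : Finset E3) (hF : (↑F : Set E3) ⊆ Layered a b w)
    {K₀ K₁ : ℤ} {M₀ : ℕ} (hM : 1 ≤ M₀) (hΛ : ∀ s ∈ idx a b w hinj F, K₀ + M₀ ≤ s.1 ∧ s.1 ≤ K₁ - M₀) :
    2 * h_lo * (F.card : ℝ) ≤ ∑ m ∈ Ioc K₀ K₁, (⟪ν, w m⟫ - ⟪ν, w (m - 1)⟫) * ((layerCount hinj F (m - 1) : ℝ) + layerCount hinj F m) ∧
      ∑ m ∈ Ioc K₀ K₁, (⟪ν, w m⟫ - ⟪ν, w (m - 1)⟫) * ((layerCount hinj F (m - 1) : ℝ) + layerCount hinj F m) ≤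
        2 * h_hi * (F.card : ℝ) := by
  have hgt_bd : ∀ m : ℤ, h_lo ≤ ⟪ν, w m⟫ - ⟪ν, w (m - 1)⟫ ∧ ⟪ν, w m⟫ - ⟪ν, w (m - 1)⟫ ≤ h_hi := fun m => by
    have h := hH (m - 1)
    rw [sub_add_cancel, inner_sub_right] at h
    exact h
  have hsum1 : ∑ m ∈ Ioc K₀ K₁, (layerCount hinj F m : ℝ) = F.card := by
    have hΛ1 : (idx a b w hinj F).image (fun s => s.1) ⊆ Ioc K₀ K₁ := by
      intro k hk
      obtain ⟨s, hs, rfl⟩ := mem_image.mp hk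
      have h := hΛ s hs
      rw [mem_Ioc]
      constructor <;> omega
    rw [← sum_subset hΛ1 (fun k _ hk => by rw [layerCount_eq_zero hinj F hk, Nat.cast_zero])]
    exact_mod_cast sum_layerCount hinj F hF
  have hsum2 : ∑ m ∈ Ioc K₀ K₁, (layerCount hinj F (m - 1) : ℝ) = F.card := by
    have hΛ2 : (idx a b w hinj F).image (fun s => s.1) ⊆ Ico K₀ K₁ := by
      intro k hk
      obtain ⟨s, hs, rfl⟩ := mem_image.mp hk
      have h := hΛ s hs
      rw [mem_Ico]
      constructor <;> omega
    have hre : ∑ m ∈ Ioc K₀ K₁, (layerCount hinj F (m - 1) : ℝ) = ∑ k ∈ Ico K₀ K₁, (layerCount hinj F k : ℝ) := by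
      refine sum_nbij' (fun m => m - 1) (fun k => k + 1) (fun m hm => ?_) (fun k hk => ?_) (fun m _ => by ring) (fun k _ => by ring)
        (fun m _ => rfl)
      · rw [mem_Ioc] at hm
        rw [mem_Ico]
        constructor <;> omega
      · rw [mem_Ico] at hk
        rw [mem_Ioc]
        constructor <;> omega
    rw [hre, ← sum_subset hΛ2 (fun k _ hk => by rw [layerCount_eq_zero hinj F hk, Nat.cast_zero])]
    exact_mod_cast sum_layerCount hinj F hF
  have hlow : ∑ m ∈ Ioc K₀ K₁, h_lo * ((layerCount hinj F (m - 1) : ℝ) + layerCount hinj F m) = 2 * h_lo * (F.card : ℝ) := by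
    rw [← mul_sum, sum_add_distrib, hsum1, hsum2]
    ring
  have hhigh : ∑ m ∈ Ioc K₀ K₁, h_hi * ((layerCount hinj F (m - 1) : ℝ) + layerCount hinj F m) = 2 * h_hi * (F.card : ℝ) := by
    rw [← mul_sum, sum_add_distrib, hsum1, hsum2]
    ring
  constructor
  · rw [← hlow]
    exact sum_le_sum fun m _ => mul_le_mul_of_nonneg_right (hgt_bd m).1 (by positivity)
  · rw [← hhigh]
    exact sum_le_sum fun m _ => mul_le_mul_of_nonneg_right (hgt_bd m).2 (by positivity)

end Planes

end Summit.AtomisticToContinuum.Crystallization.Theorems.ChartedPlanarOrderPlanesVirial
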